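import Literature.MathematicalPhysics.QuantumLattice.LiebWuFillingContinuity
import Literature.MathematicalPhysics.QuantumLattice.LiebWuRho0Bounds
import HarnessLib

/-!
# Lieb–Wu 2003, §7.1, the Plancherel step: `∫ √(1 - x²) u(x) dx = ∫₀^∞ J₁(ω)/(ω(1 + e^{ωU/2})) dω`
# in the momentum picture, and the test function it pairs with

E. H. Lieb, F. Y. Wu, Physica A 321 (2003) 1, §7.1 (arXiv:cond-mat/0207529, p. 16) reduce the energy
change `δE` near half filling to the integral `∫_{-1}^{1} √(1 - x²) u(x) dx` (eq. (dint); `u` = the kernel of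
`Û = K̂²(1 + K̂²)⁻¹`, here `fermiKernel (U/4)`), "most easily evaluated using Fourier transforms and
Plancherel's theorem":

> `∫_{-1}^{1} √(1 - x²) e^{iωx} dx = 2∫₀^{π/2} cos(ω sin θ) cos²θ dθ = (π/ω) J₁(ω)`,          (semicircle)
> `∫ u(x) e^{iωx} dx = [1 + e^{|ω|U/2}]⁻¹`,                                                     (FT)
> whence `δE/N_a = 2a[ρ₀(0) - 1/π][2 - 4∫₀^∞ J₁(ω)/(ω[1 + exp(ωU/2)]) dω]`.                    (finaldeltae)

This file supplies that step in the form used by `LiebWuChemicalPotentialEnergy.lean`, where the energy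
`E/N_a = -2∫_{-Q}^{Q} ρ cos k` is kept in the momentum variable (`x = sin k`, `√(1 - x²) dx ↔ cos²k dk`):

* `integral_sechKernel_mul_cosSqCauchy`: for the test function
  `V(t) = ∫_{-π}^{π} cos²k K_{U/4}(sin k - t) dk` (the `cos²`-moment of the Cauchy kernel, i.e.
  `2∫_{-1}^{1} √(1 - x²) K(x - t) dx`),
  `∫ r(t) V(t) dt = 4 ∫₀^∞ J₁(ω)/(ω(1 + e^{ωU/2})) dω` — from `r ∗ K = 2u`
  (`integral_sechKernel_mul_cauchyDensity`), the cosine representation of `u` (`fermiKernel`, eq. (FT))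
  and `ω ∫_{-π}^{π} cos²k cos(ω sin k) dk = 2π J₁(ω)` (`mul_integral_cos_sq_mul_cos_mul_sin`, eq. (semicircle));
* `integral_cos_sq_mul_conv_cauchyDensity`: Fubini, `∫_{-π}^{π} cos²k (h ∗ K)(sin k) dk = ∫ h V`;
* bounds: `0 ≤ V ≤ 2/(U/4)`, `|V(t) - V(t')| ≤ 2|t - t'|/(U/4)²` (`cosSqCauchy_nonneg_le`,
  `abs_cosSqCauchy_sub_le`).

No named facts; all statements proved.

## References

* E. H. Lieb, F. Y. Wu, Physica A 321 (2003) 1–27 = arXiv:cond-mat/0207529, §7.1, eqs. (dint),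
  (semicircle), (FT), (finaldeltae) [LiebWuPhysicaA2003].
-/

noncomputable section

open MeasureTheory Set Real Filter intervalIntegral
open Literature.Analysis.SpecialFunctions Literature.Analysis.FunctionSpaces
open scoped Topology Interval

namespace Literature.MathematicalPhysics.QuantumLattice

variable {U : ℝ}

/-! ### The test function `V(t) = ∫_{-π}^{π} cos²k K(sin k - t) dk` -/

/-- `|K_c(x) - K_c(x')| ≤ |x - x'|/(π c²)`. [folklore] -/
private theorem abs_cauchyDensity_sub_le' {c : ℝ} (hc : 0 < c) (x x' : ℝ) :
    |cauchyDensity c x - cauchyDensity c x'| ≤ |x - x'| / (π * c ^ 2) := by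
  have hπ := Real.pi_pos
  have h1 : 0 < c ^ 2 + x ^ 2 := by positivity
  have h2 : 0 < c ^ 2 + x' ^ 2 := by positivity
  have hsub : cauchyDensity c x - cauchyDensity c x' =
      c * ((x' - x) * (x' + x)) / (π * ((c ^ 2 + x ^ 2) * (c ^ 2 + x' ^ 2))) := by
    rw [cauchyDensity, cauchyDensity]
    field_simp
    ring
  have hkey : c ^ 3 * |x' + x| ≤ (c ^ 2 + x ^ 2) * (c ^ 2 + x' ^ 2) := by
    have hx : 2 * c * |x| ≤ c ^ 2 + x ^ 2 := by nlinarith [sq_nonneg (c - |x|), sq_abs x, abs_nonneg x]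
    have hx' : 2 * c * |x'| ≤ c ^ 2 + x' ^ 2 := by
      nlinarith [sq_nonneg (c - |x'|), sq_abs x', abs_nonneg x']
    have htri : |x' + x| ≤ |x'| + |x| := abs_add_le _ _
    have hc2 : 0 < c ^ 2 := by positivity
    calc c ^ 3 * |x' + x| ≤ c ^ 3 * (|x'| + |x|) := by gcongr
      _ = c ^ 2 / 2 * (2 * c * |x'|) + c ^ 2 / 2 * (2 * c * |x|) := by ring
      _ ≤ c ^ 2 / 2 * (c ^ 2 + x' ^ 2) + c ^ 2 / 2 * (c ^ 2 + x ^ 2) := by gcongr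
      _ ≤ (c ^ 2 + x ^ 2) * (c ^ 2 + x' ^ 2) := by nlinarith [sq_nonneg x, sq_nonneg x', sq_nonneg (x * x')]
  rw [hsub, abs_div, abs_of_pos (by positivity : 0 < π * ((c ^ 2 + x ^ 2) * (c ^ 2 + x' ^ 2))),
    abs_mul, abs_of_pos hc, abs_mul, div_le_div_iff₀ (by positivity) (by positivity), abs_sub_comm x x']
  calc c * (|x' - x| * |x' + x|) * (π * c ^ 2) = |x' - x| * π * (c ^ 3 * |x' + x|) := by ring
    _ ≤ |x' - x| * π * ((c ^ 2 + x ^ 2) * (c ^ 2 + x' ^ 2)) := by gcongr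
    _ = |x' - x| * (π * ((c ^ 2 + x ^ 2) * (c ^ 2 + x' ^ 2))) := by ring

/-- `V ≥ 0` and `V ≤ 2/c` (`K ≤ 1/(πc)`, `∫_{-π}^{π} cos² ≤ 2π`) — the weight of eq. (dint) in the momentum
variable is bounded. [cite: LiebWuPhysicaA2003, §7.1, eq. (dint) (the weight √(1-x²) against K)] -/
theorem cosSqCauchy_nonneg_le (hU : 0 < U) (t : ℝ) :
    0 ≤ ∫ k in (-π)..π, Real.cos k ^ 2 * cauchyDensity (U / 4) (Real.sin k - t) ∧
      ∫ k in (-π)..π, Real.cos k ^ 2 * cauchyDensity (U / 4) (Real.sin k - t) ≤ 2 / (U / 4) := by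
  have hc : 0 < U / 4 := by positivity
  have hπ := Real.pi_pos
  have hK := continuous_cauchyDensity hc
  have hcont : Continuous fun k => Real.cos k ^ 2 * cauchyDensity (U / 4) (Real.sin k - t) := by fun_prop
  refine ⟨intervalIntegral.integral_nonneg (by linarith) fun k _ =>
    mul_nonneg (sq_nonneg _) (cauchyDensity_pos hc _).le, ?_⟩
  have hb : ∀ k ∈ Icc (-π) π, Real.cos k ^ 2 * cauchyDensity (U / 4) (Real.sin k - t) ≤ 1 / (π * (U / 4)) := by
    intro k _
    have h1 : Real.cos k ^ 2 ≤ 1 := by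
      rw [sq_le_one_iff_abs_le_one]; exact Real.abs_cos_le_one k
    calc Real.cos k ^ 2 * cauchyDensity (U / 4) (Real.sin k - t) ≤ 1 * (1 / (π * (U / 4))) :=
          mul_le_mul h1 (cauchyDensity_le hc _) (cauchyDensity_pos hc _).le zero_le_one
      _ = 1 / (π * (U / 4)) := one_mul _
  have h := intervalIntegral.integral_mono_on (by linarith) (hcont.intervalIntegrable _ _)
    (intervalIntegrable_const (μ := volume)) hb
  rw [intervalIntegral.integral_const, smul_eq_mul] at h
  calc ∫ k in (-π)..π, Real.cos k ^ 2 * cauchyDensity (U / 4) (Real.sin k - t)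
      ≤ (π - -π) * (1 / (π * (U / 4))) := h
    _ = 2 / (U / 4) := by field_simp; ring

/-- `V` is Lipschitz: `|V(t) - V(t')| ≤ 2|t - t'|/c²` — the quantitative form of "if `g` is continuous near
`0` … then `(ûâ g)(x) ≈ 2a u(x - 0) g(0)` to leading order in `a`" for the weight of (dint).
[cite: LiebWuPhysicaA2003, §7.1, sentence before eq. (dint)] -/
theorem abs_cosSqCauchy_sub_le (hU : 0 < U) (t t' : ℝ) :
    |(∫ k in (-π)..π, Real.cos k ^ 2 * cauchyDensity (U / 4) (Real.sin k - t)) -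
        ∫ k in (-π)..π, Real.cos k ^ 2 * cauchyDensity (U / 4) (Real.sin k - t')| ≤
      2 * |t - t'| / (U / 4) ^ 2 := by
  have hc : 0 < U / 4 := by positivity
  have hπ := Real.pi_pos
  have hK := continuous_cauchyDensity hc
  have hcont : ∀ s, Continuous fun k => Real.cos k ^ 2 * cauchyDensity (U / 4) (Real.sin k - s) :=
    fun s => by fun_prop
  rw [← intervalIntegral.integral_sub ((hcont t).intervalIntegrable _ _) ((hcont t').intervalIntegrable _ _)]
  have hb : ∀ k ∈ Ι (-π) π, ‖Real.cos k ^ 2 * cauchyDensity (U / 4) (Real.sin k - t) -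
      Real.cos k ^ 2 * cauchyDensity (U / 4) (Real.sin k - t')‖ ≤ |t - t'| / (π * (U / 4) ^ 2) := by
    intro k _
    rw [← mul_sub, Real.norm_eq_abs, abs_mul, abs_of_nonneg (sq_nonneg _)]
    have h1 : Real.cos k ^ 2 ≤ 1 := by
      rw [sq_le_one_iff_abs_le_one]; exact Real.abs_cos_le_one k
    have h2 := abs_cauchyDensity_sub_le' hc (Real.sin k - t) (Real.sin k - t')
    rw [show Real.sin k - t - (Real.sin k - t') = t' - t by ring, abs_sub_comm t' t] at h2
    calc Real.cos k ^ 2 * |cauchyDensity (U / 4) (Real.sin k - t) - cauchyDensity (U / 4) (Real.sin k - t')|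
        ≤ 1 * (|t - t'| / (π * (U / 4) ^ 2)) := mul_le_mul h1 h2 (abs_nonneg _) zero_le_one
      _ = |t - t'| / (π * (U / 4) ^ 2) := one_mul _
  have h := intervalIntegral.norm_integral_le_of_norm_le_const hb
  rw [Real.norm_eq_abs, show |π - -π| = 2 * π by rw [sub_neg_eq_add, abs_of_pos (by linarith)]; ring] at h
  calc |∫ k in (-π)..π, (Real.cos k ^ 2 * cauchyDensity (U / 4) (Real.sin k - t) -
        Real.cos k ^ 2 * cauchyDensity (U / 4) (Real.sin k - t'))|
      ≤ |t - t'| / (π * (U / 4) ^ 2) * (2 * π) := h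
    _ = 2 * |t - t'| / (U / 4) ^ 2 := by field_simp

/-- `V` is continuous (weight of eq. (dint) in the momentum variable). [cite: LiebWuPhysicaA2003, §7.1, eq. (dint)] -/
theorem continuous_cosSqCauchy (hU : 0 < U) :
    Continuous fun t => ∫ k in (-π)..π, Real.cos k ^ 2 * cauchyDensity (U / 4) (Real.sin k - t) := by
  have hc : 0 < U / 4 := by positivity
  have hK := continuous_cauchyDensity hc
  exact intervalIntegral.continuous_parametric_intervalIntegral_of_continuous' (μ := volume)
    (by fun_prop) _ _

/-! ### Fubini: `∫_{-π}^{π} cos²k (h ∗ K)(sin k) dk = ∫ h V` -/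

/-- **Fubini for the `cos²`-moment of `h ∗ K`:** for `h` continuous and integrable,
`∫_{-π}^{π} cos²k (∫ h(t) K(sin k - t) dt) dk = ∫ h(t) V(t) dt` — the exchange behind
"`∫₀^{π/2} ρ(k) cos k dk = ∫₀¹ f(x) √(1 - x²) dx`" and eq. (dint). [cite: LiebWuPhysicaA2003, §7.1, eq. (dint)] -/
theorem integral_cos_sq_mul_conv_cauchyDensity (hU : 0 < U) {h : ℝ → ℝ} (hhc : Continuous h)
    (hhi : Integrable h) :
    ∫ k in (-π)..π, Real.cos k ^ 2 * ∫ t, h t * cauchyDensity (U / 4) (Real.sin k - t) =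
      ∫ t, h t * ∫ k in (-π)..π, Real.cos k ^ 2 * cauchyDensity (U / 4) (Real.sin k - t) := by
  have hc : 0 < U / 4 := by positivity
  have hK := continuous_cauchyDensity hc
  set F : ℝ → ℝ → ℝ := fun k t => Real.cos k ^ 2 * (h t * cauchyDensity (U / 4) (Real.sin k - t)) with hF
  have hleft : ∀ k, Real.cos k ^ 2 * ∫ t, h t * cauchyDensity (U / 4) (Real.sin k - t) = ∫ t, F k t :=
    fun k => by rw [hF]; exact (MeasureTheory.integral_const_mul _ _).symm
  have hright : ∀ t, h t * ∫ k in (-π)..π, Real.cos k ^ 2 * cauchyDensity (U / 4) (Real.sin k - t) =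
      ∫ k in (-π)..π, F k t := by
    intro t
    rw [hF, ← intervalIntegral.integral_const_mul]
    exact intervalIntegral.integral_congr fun k _ => by ring
  simp_rw [hleft, hright]
  have hint : Integrable (Function.uncurry F) ((volume.restrict (Ι (-π) π)).prod volume) := by
    haveI : IsFiniteMeasure (volume.restrict (Ι (-π) π)) := by
      refine isFiniteMeasure_restrict.2 ?_
      simp [Set.uIoc, Real.volume_Ioc]
    have hg : Integrable (fun z : ℝ × ℝ => (1 : ℝ) * (|h z.2| * (1 / (π * (U / 4)))))
        ((volume.restrict (Ι (-π) π)).prod volume) :=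
      Integrable.mul_prod (integrable_const 1) (hhi.abs.mul_const _)
    refine hg.mono' (by fun_prop : Continuous (Function.uncurry F)).aestronglyMeasurable
      (Eventually.of_forall fun z => ?_)
    rcases z with ⟨k, t⟩
    simp only [Function.uncurry_apply_pair, hF, Real.norm_eq_abs, one_mul]
    rw [abs_mul, abs_mul, abs_of_nonneg (sq_nonneg _), abs_of_pos (cauchyDensity_pos hc _)]
    have h1 : Real.cos k ^ 2 ≤ 1 := by
      rw [sq_le_one_iff_abs_le_one]; exact Real.abs_cos_le_one k
    calc Real.cos k ^ 2 * (|h t| * cauchyDensity (U / 4) (Real.sin k - t))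
        ≤ 1 * (|h t| * (1 / (π * (U / 4)))) := by
          gcongr
          · exact mul_nonneg (abs_nonneg _) (cauchyDensity_pos hc _).le
          · exact cauchyDensity_le hc _
      _ = |h t| * (1 / (π * (U / 4))) := one_mul _
  exact MeasureTheory.intervalIntegral_integral_swap hint

/-! ### The constant: `∫ r V = 4 ∫₀^∞ J₁/(ω(1 + e^{ωU/2}))` -/

/-- `∫_{-π}^{π} cos²k u(sin k) dk = 2 ∫₀^∞ J₁(ω)/(ω(1 + e^{ωU/2})) dω` (`u = fermiKernel (U/4)`): the
momentum form of `∫_{-1}^{1} √(1 - x²) u(x) dx = ∫₀^∞ J₁/(ω(1 + e^{ωU/2}))`, eqs. (dint), (semicircle), (FT).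
[cite: LiebWuPhysicaA2003, §7.1, eqs. (dint)–(FT)] -/
theorem integral_cos_sq_mul_fermiKernel_sin (hU : 0 < U) :
    ∫ k in (-π)..π, Real.cos k ^ 2 * fermiKernel (U / 4) (Real.sin k) =
      2 * ∫ ω in Ioi (0 : ℝ), liebWuChargeGapIntegrand U ω := by
  have hπ := Real.pi_pos
  have ha : 0 < U / 2 := by positivity
  have hφc := continuous_fermiFn (U / 2)
  -- `cos²k u(sin k) = π⁻¹ ∫₀^∞ cos²k cos(ω sin k) φ(ω) dω`
  set F : ℝ → ℝ → ℝ := fun k ω => Real.cos k ^ 2 * (Real.cos (ω * Real.sin k) * fermiFn (U / 2) ω) with hF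
  have hpt : ∀ k, Real.cos k ^ 2 * fermiKernel (U / 4) (Real.sin k) = π⁻¹ * ∫ ω in Ioi (0 : ℝ), F k ω := by
    intro k
    rw [fermiKernel, fermiCos, show 2 * (U / 4) = U / 2 by ring, hF, MeasureTheory.integral_const_mul]
    ring
  simp_rw [hpt]
  rw [intervalIntegral.integral_const_mul]
  -- Fubini on `Ι(-π, π) × (0, ∞)`, dominated by `e^{-(U/2)ω}`
  have hint : Integrable (Function.uncurry F) ((volume.restrict (Ι (-π) π)).prod (volume.restrict (Ioi 0))) := by
    haveI : IsFiniteMeasure (volume.restrict (Ι (-π) π)) := by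
      refine isFiniteMeasure_restrict.2 ?_
      simp [Set.uIoc, Real.volume_Ioc]
    have hg : Integrable (fun z : ℝ × ℝ => (1 : ℝ) * Real.exp (-(U / 2) * z.2))
        ((volume.restrict (Ι (-π) π)).prod (volume.restrict (Ioi (0 : ℝ)))) :=
      Integrable.mul_prod (integrable_const 1) (exp_neg_integrableOn_Ioi 0 ha)
    refine hg.mono' (by fun_prop : Continuous (Function.uncurry F)).aestronglyMeasurable
      (Eventually.of_forall fun z => ?_)
    rcases z with ⟨k, ω⟩
    simp only [Function.uncurry_apply_pair, hF, Real.norm_eq_abs, one_mul]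
    rw [abs_mul, abs_mul, abs_of_nonneg (sq_nonneg _), abs_of_pos (fermiFn_pos _ _)]
    have h1 : Real.cos k ^ 2 ≤ 1 := by
      rw [sq_le_one_iff_abs_le_one]; exact Real.abs_cos_le_one k
    have h2 := Real.abs_cos_le_one (ω * Real.sin k)
    have h3 : fermiFn (U / 2) ω ≤ Real.exp (-(U / 2) * ω) := by
      have := fermiFn_le_exp_neg (c := U / 2) ω; rwa [neg_mul] at *
    calc Real.cos k ^ 2 * (|Real.cos (ω * Real.sin k)| * fermiFn (U / 2) ω)
        ≤ 1 * (1 * Real.exp (-(U / 2) * ω)) :=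
          mul_le_mul h1 (mul_le_mul h2 h3 (fermiFn_pos _ _).le zero_le_one)
            (mul_nonneg (abs_nonneg _) (fermiFn_pos _ _).le) zero_le_one
      _ = Real.exp (-(U / 2) * ω) := by ring
  rw [MeasureTheory.intervalIntegral_integral_swap hint]
  -- the inner `k`-integral: `∫ cos²k cos(ω sin k) dk = 2π J₁(ω)/ω` for `ω > 0`
  have hinner : ∀ ω ∈ Ioi (0 : ℝ), ∫ k in (-π)..π, F k ω = 2 * π * (besselJ 1 ω / ω) * fermiFn (U / 2) ω := by
    intro ω hω
    have hω : (0 : ℝ) < ω := hω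
    have h := mul_integral_cos_sq_mul_cos_mul_sin ω
    have e : (fun k => F k ω) = fun k => fermiFn (U / 2) ω * (Real.cos k ^ 2 * Real.cos (ω * Real.sin k)) := by
      funext k; simp only [hF]; ring
    rw [e, intervalIntegral.integral_const_mul]
    have : ∫ k in (-π)..π, Real.cos k ^ 2 * Real.cos (ω * Real.sin k) = 2 * π * besselJ 1 ω / ω := by
      rw [eq_div_iff hω.ne']; linarith
    rw [this]
    ring
  rw [setIntegral_congr_fun measurableSet_Ioi hinner]
  have e2 : (fun ω => 2 * π * (besselJ 1 ω / ω) * fermiFn (U / 2) ω) =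
      fun ω => 2 * π * liebWuChargeGapIntegrand U ω := by
    funext ω
    rw [liebWuChargeGapIntegrand, fermiFn, show U / 2 * ω = ω * U / 2 by ring]
    have : 0 < 1 + Real.exp (ω * U / 2) := by positivity
    field_simp
  rw [e2, MeasureTheory.integral_const_mul]
  field_simp

/-- **`∫ r(t) V(t) dt = 4 ∫₀^∞ J₁(ω)/(ω(1 + e^{ωU/2})) dω`** (`r ∗ K = 2u` and the previous lemma): the
constant multiplying the first-order response in (finaldeltae). [cite: LiebWuPhysicaA2003, §7.1, eq. (finaldeltae)] -/
theorem integral_sechKernel_mul_cosSqCauchy (hU : 0 < U) :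
    ∫ t, sechKernel (U / 4) t * ∫ k in (-π)..π, Real.cos k ^ 2 * cauchyDensity (U / 4) (Real.sin k - t) =
      4 * ∫ ω in Ioi (0 : ℝ), liebWuChargeGapIntegrand U ω := by
  have hc : 0 < U / 4 := by positivity
  rw [← integral_cos_sq_mul_conv_cauchyDensity hU (continuous_sechKernel hc) (integrable_sechKernel hc)]
  have hinner : ∀ k, ∫ t, sechKernel (U / 4) t * cauchyDensity (U / 4) (Real.sin k - t) =
      2 * fermiKernel (U / 4) (Real.sin k) := fun k => integral_sechKernel_mul_cauchyDensity hc _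
  simp_rw [hinner]
  have e : (fun k => Real.cos k ^ 2 * (2 * fermiKernel (U / 4) (Real.sin k))) =
      fun k => 2 * (Real.cos k ^ 2 * fermiKernel (U / 4) (Real.sin k)) := by funext k; ring
  rw [e, intervalIntegral.integral_const_mul, integral_cos_sq_mul_fermiKernel_sin hU]
  ring

/-- **`∫ r(t - y) V(t) dt` is Lipschitz in `y`:** `|R(y) - R(y')| ≤ 2|y - y'|/c²` (`∫ r = 1`, `V`
Lipschitz) — the quantitative form of "`(ûâ g)(x) ≈ 2a u(x - 0) g(0)` to leading order in `a`" for the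
`R̂`-images entering `δσ`. [cite: LiebWuPhysicaA2003, §7.1, sentence before eq. (dint)] -/
theorem abs_integral_sechKernel_sub_mul_cosSqCauchy_sub_le (hU : 0 < U) (y y' : ℝ) :
    |(∫ t, sechKernel (U / 4) (t - y) * ∫ k in (-π)..π, Real.cos k ^ 2 * cauchyDensity (U / 4) (Real.sin k - t)) -
        ∫ t, sechKernel (U / 4) (t - y') * ∫ k in (-π)..π, Real.cos k ^ 2 * cauchyDensity (U / 4) (Real.sin k - t)|
      ≤ 2 * |y - y'| / (U / 4) ^ 2 := by
  have hc : 0 < U / 4 := by positivity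
  set V : ℝ → ℝ := fun t => ∫ k in (-π)..π, Real.cos k ^ 2 * cauchyDensity (U / 4) (Real.sin k - t) with hV
  have hVc : Continuous V := continuous_cosSqCauchy hU
  have hVb : ∀ t, |V t| ≤ 2 / (U / 4) := fun t => by
    rw [abs_of_nonneg (cosSqCauchy_nonneg_le hU t).1]; exact (cosSqCauchy_nonneg_le hU t).2
  have hri := integrable_sechKernel hc
  -- translate: `∫ r(t - y) V(t) dt = ∫ r(s) V(s + y) ds`
  have htr : ∀ z, ∫ t, sechKernel (U / 4) (t - z) * V t = ∫ s, sechKernel (U / 4) s * V (s + z) := by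
    intro z
    have h := MeasureTheory.integral_add_right_eq_self (μ := volume) (fun t => sechKernel (U / 4) (t - z) * V t) z
    simp only [add_sub_cancel_right] at h
    exact h.symm
  have hI : ∀ z, Integrable fun s => sechKernel (U / 4) s * V (s + z) := fun z =>
    hri.mul_bdd ((hVc.comp (continuous_id.add continuous_const)).aestronglyMeasurable)
      (Eventually.of_forall fun s => by rw [Real.norm_eq_abs]; exact hVb _)
  show |(∫ t, sechKernel (U / 4) (t - y) * V t) - ∫ t, sechKernel (U / 4) (t - y') * V t| ≤ _
  rw [htr y, htr y', ← integral_sub (hI y) (hI y')]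
  have e : (fun s => sechKernel (U / 4) s * V (s + y) - sechKernel (U / 4) s * V (s + y')) =
      fun s => sechKernel (U / 4) s * (V (s + y) - V (s + y')) := by funext s; ring
  rw [e]
  have hb : ∀ s, |sechKernel (U / 4) s * (V (s + y) - V (s + y'))| ≤ sechKernel (U / 4) s * (2 * |y - y'| / (U / 4) ^ 2) := by
    intro s
    rw [abs_mul, abs_of_pos (sechKernel_pos hc _)]
    refine mul_le_mul_of_nonneg_left ?_ (sechKernel_pos hc _).le
    have h := abs_cosSqCauchy_sub_le hU (s + y) (s + y')
    rwa [show s + y - (s + y') = y - y' by ring] at h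
  calc |∫ s, sechKernel (U / 4) s * (V (s + y) - V (s + y'))|
      ≤ ∫ s, |sechKernel (U / 4) s * (V (s + y) - V (s + y'))| := MeasureTheory.abs_integral_le_integral_abs
    _ ≤ ∫ s, sechKernel (U / 4) s * (2 * |y - y'| / (U / 4) ^ 2) :=
        integral_mono_of_nonneg (Eventually.of_forall fun s => abs_nonneg _) (hri.mul_const _)
          (Eventually.of_forall hb)
    _ = 2 * |y - y'| / (U / 4) ^ 2 := by rw [MeasureTheory.integral_mul_const, integral_sechKernel hc, one_mul]

end Literature.MathematicalPhysics.QuantumLattice
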